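import Summits.QuantumFields.YangMills.Theorems.LuscherReductionOneSiteLevelsKacSpan
import Summits.QuantumFields.YangMills.Theorems.LuscherReductionOneSiteLevelsKacGreen

/-!
# INNER, flat lane (layer III): the span bound `kacForm t F ≥ Σ c_j² E_j − K t Σ c_j²` (III.8, `O(t)` deficit)

Support module of crux `OneSiteLevels` (route `LuscherReduction`, item stmt-QuantumFields-20007), FLAT lane of the
registered v12 stub `stub_flatKacAL1` (STUB-PLAN rev 3 rows III.4/III.8; trap 17: the span part needs an `O(t)` deficit).

For the eigen-span `F = Σ c_j f_j` of an AL1 family, on the Fourier side (`a(ξ) = 2π²‖ξ‖²` = symbol of `H₀ = −½Δ`):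
`flatJump t F = ∫ (1 − e^{−t a})/t ‖𝓕F‖²`, `½∫‖∇F‖² = ∫ a ‖𝓕F‖²`, `∫ (H₀F)² = ∫ a² ‖𝓕F‖²`, and the scalar inequality
`(1 − e^{−x}) ≥ x − x²/2` give `flatJump t F ≥ ½∫‖∇F‖² − (t/2)∫(H₀F)²`; with Green on the span (`energyForm_span`) and
`∫(H₀F)² ≤ K Σ c_j²`:  **`kacForm t F ≥ Σ c_j² E_j − (K/2)·t·Σ c_j²`** (`kacForm_span_ge`).

Real analysis only ([folklore]); NOT the stub; femto rung R2b1; NOT a claim about the gap.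
-/

set_option autoImplicit false

noncomputable section

open MeasureTheory Filter Topology Real Complex FourierTransform
open scoped RealInnerProductSpace
open Literature.Analysis.OperatorTheory.YMMatrixModel

namespace Summit.QuantumFields.YangMills.Theorems.FemtoTransferGap

/-- `x − x²/2 ≤ 1 − e^{−x}` for `x ≥ 0`. [folklore] -/
theorem sub_sq_div_two_le_one_sub_exp_neg {x : ℝ} (hx : 0 ≤ x) : x - x ^ 2 / 2 ≤ 1 - Real.exp (-x) := by
  let g : ℝ → ℝ := fun u => 1 - u + u * u / 2 - Real.exp (-u)
  have hg : ∀ u, HasDerivAt g (-1 + u + Real.exp (-u)) u := by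
    intro u
    have h1 : HasDerivAt (fun u : ℝ => 1 - u + u * u / 2) (0 - 1 + (1 * u + u * 1) / 2) u :=
      ((hasDerivAt_const u 1).sub (hasDerivAt_id u)).add (((hasDerivAt_id u).mul (hasDerivAt_id u)).div_const 2)
    have h2 : HasDerivAt (fun u : ℝ => Real.exp (-u)) (Real.exp (-u) * -1) u := (hasDerivAt_id u).neg.exp
    refine (h1.sub h2).congr_deriv ?_
    ring
  have hmono : MonotoneOn g (Set.Ici 0) :=
    monotoneOn_of_deriv_nonneg (convex_Ici 0) (fun u _ => (hg u).continuousAt.continuousWithinAt)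
      (fun u _ => (hg u).differentiableAt.differentiableWithinAt) fun u _ => by
        rw [(hg u).deriv]
        linarith [Real.add_one_le_exp (-u)]
  have h0 : g 0 ≤ g x := hmono Set.self_mem_Ici hx hx
  have hg0 : g 0 = 0 := by simp [g]
  rw [hg0] at h0
  simp only [g] at h0
  nlinarith [h0]

/-- The multiplier inequality: `(1 − e^{−ta})/t ≥ a − t a²/2` for `a ≥ 0`, `t > 0`. [folklore] -/
theorem mult_ge {t a : ℝ} (ht : 0 < t) (ha : 0 ≤ a) : a - t * a ^ 2 / 2 ≤ (1 - Real.exp (-(t * a))) / t := by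
  rw [le_div_iff₀ ht]
  have h := sub_sq_div_two_le_one_sub_exp_neg (mul_nonneg ht.le ha)
  nlinarith [h]

section SpanBound

variable {m : ℕ} {f : Fin (m + 1) → ZM → ℝ} (hf : IsEigenFamily m f)
include hf

/-- **Fourier transform of `H₀F`**: `𝓕(cpx H₀F) ξ = 2π²‖ξ‖² · 𝓕(cpx F) ξ`. [folklore] -/
theorem fourier_cpx_eigSpanH0 (c : Fin (m + 1) → ℝ) (ξ : ZM) :
    𝓕 (cpx (eigSpanH0 f c)) ξ = ((2 * π ^ 2 * ‖ξ‖ ^ 2 : ℝ) : ℂ) * 𝓕 (cpx (eigSpan f c)) ξ := by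
  obtain ⟨hI0, hI1, hI2, -, -, hD0, hD1⟩ := eigSpan_integrable hf c
  have h2 : ContDiff ℝ 2 (eigSpan f c) := eigSpan_contDiff hf c 2
  have h1 : ContDiff ℝ 1 (eigSpan f c) := h2.of_le (by norm_num)
  have h1p : ∀ p, ContDiff ℝ 1 (pderiv p (eigSpan f c)) := contDiff_one_pderiv h2
  -- `cpx H₀F = -(1/2) Σ_p cpx (∂_p∂_p F)`
  have e : cpx (eigSpanH0 f c) = fun x => (-(1 / 2 : ℝ) : ℂ) * ∑ p, cpx (pderiv p (pderiv p (eigSpan f c))) x := by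
    funext x
    rw [cpx_apply, eigSpanH0_apply, laplacian_def]
    push_cast
    simp only [cpx_apply]
  rw [e, fourier_const_mul_apply, fourier_sum_apply _ (fun p => integrable_cpx (hI2 p p))]
  -- each term: two applications of the derivative rule
  have hterm : ∀ p, 𝓕 (cpx (pderiv p (pderiv p (eigSpan f c)))) ξ =
      (2 * π * I * ((ξ p : ℝ) : ℂ)) * ((2 * π * I * ((ξ p : ℝ) : ℂ)) * 𝓕 (cpx (eigSpan f c)) ξ) := fun p => by
    rw [fourier_cpx_pderiv (h1p p) (hI1 p) (hD1 p) p ξ, fourier_cpx_pderiv h1 hI0 hD0 p ξ]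
  simp_rw [hterm]
  have e2 : ∑ p, 2 * π * I * ((ξ p : ℝ) : ℂ) * (2 * π * I * ((ξ p : ℝ) : ℂ) * 𝓕 (cpx (eigSpan f c)) ξ) =
      (2 * π * I) ^ 2 * (∑ p, ((ξ p : ℝ) : ℂ) ^ 2) * 𝓕 (cpx (eigSpan f c)) ξ := by
    rw [Finset.mul_sum, Finset.sum_mul]
    exact Finset.sum_congr rfl fun p _ => by ring
  rw [e2]
  have e3 : (∑ p, ((ξ p : ℝ) : ℂ) ^ 2) = ((‖ξ‖ ^ 2 : ℝ) : ℂ) := by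
    rw [← sum_sq_coord]; push_cast; rfl
  rw [e3, mul_pow, mul_pow, Complex.I_sq]
  push_cast
  ring

/-- `∫ (H₀F)² = ∫ (2π²‖ξ‖²)² ‖𝓕(cpx F)‖²`. [folklore] -/
theorem integral_eigSpanH0_sq_eq_fourier (c : Fin (m + 1) → ℝ) :
    ∫ x, eigSpanH0 f c x ^ 2 = ∫ ξ, (2 * π ^ 2 * ‖ξ‖ ^ 2) ^ 2 * ‖𝓕 (cpx (eigSpan f c)) ξ‖ ^ 2 := by
  rw [l2_eq_fourier (eigSpanH0_integrable hf c) (integral_eigSpanH0_sq_le hf c).1]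
  refine integral_congr_ae (Eventually.of_forall fun ξ => ?_)
  show ‖𝓕 (cpx (eigSpanH0 f c)) ξ‖ ^ 2 = (2 * π ^ 2 * ‖ξ‖ ^ 2) ^ 2 * ‖𝓕 (cpx (eigSpan f c)) ξ‖ ^ 2
  rw [fourier_cpx_eigSpanH0 hf c ξ, norm_mul, Complex.norm_real, Real.norm_eq_abs,
    abs_of_nonneg (by positivity : (0:ℝ) ≤ 2 * π ^ 2 * ‖ξ‖ ^ 2), mul_pow]

/-- The Fourier-side weights are integrable: `a ‖𝓕F‖²` and `a² ‖𝓕F‖²`. [folklore] -/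
theorem integrable_symbol_mul_norm_sq_fourier (c : Fin (m + 1) → ℝ) :
    Integrable (fun ξ : ZM => 2 * π ^ 2 * ‖ξ‖ ^ 2 * ‖𝓕 (cpx (eigSpan f c)) ξ‖ ^ 2) ∧
      Integrable (fun ξ : ZM => (2 * π ^ 2 * ‖ξ‖ ^ 2) ^ 2 * ‖𝓕 (cpx (eigSpan f c)) ξ‖ ^ 2) := by
  obtain ⟨hI0, hI1, -, -, hP2, hD0, -⟩ := eigSpan_integrable hf c
  have h1 : ContDiff ℝ 1 (eigSpan f c) := (eigSpan_contDiff hf c 2).of_le (by norm_num)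
  refine ⟨(half_sum_integral_pderiv_sq_eq_fourier h1 hI0 hD0 hI1 hP2).1, ?_⟩
  have h := integrable_norm_sq_fourier_cpx (eigSpanH0_integrable hf c) (integral_eigSpanH0_sq_le hf c).1
  refine h.congr (Eventually.of_forall fun ξ => ?_)
  show ‖𝓕 (cpx (eigSpanH0 f c)) ξ‖ ^ 2 = (2 * π ^ 2 * ‖ξ‖ ^ 2) ^ 2 * ‖𝓕 (cpx (eigSpan f c)) ξ‖ ^ 2
  rw [fourier_cpx_eigSpanH0 hf c ξ, norm_mul, Complex.norm_real, Real.norm_eq_abs,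
    abs_of_nonneg (by positivity : (0:ℝ) ≤ 2 * π ^ 2 * ‖ξ‖ ^ 2), mul_pow]

/-- **The jump form of the span on the Fourier side**:
`flatJump t F = ∫ (1 − e^{−2π²t‖ξ‖²})/t · ‖𝓕(cpx F)‖²`. [folklore] -/
theorem flatJump_eigSpan_eq_fourier (c : Fin (m + 1) → ℝ) {t : ℝ} (ht : 0 < t) :
    flatJump t (eigSpan f c) =
      ∫ ξ, (1 - Real.exp (-(t * (2 * π ^ 2 * ‖ξ‖ ^ 2)))) / t * ‖𝓕 (cpx (eigSpan f c)) ξ‖ ^ 2 := by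
  obtain ⟨C, hC0, hC⟩ := eigSpan_decay hf c
  obtain ⟨hI0, -, -, hS0, -⟩ := eigSpan_integrable hf c
  have hcont : Continuous (eigSpan f c) := (eigSpan_contDiff hf c 0).continuous
  have hb : ∀ x, |eigSpan f c x| ≤ C := fun x =>
    ((hC x).1).trans (by nlinarith [Real.exp_le_one_iff.mpr (neg_nonpos.mpr (norm_nonneg x)), Real.exp_pos (-‖x‖)])
  rw [flatJump_eq_mass_defect ht hcont.measurable hb hI0]
  -- the two masses on the Fourier side
  have hm2 : MemLp (eigSpan f c) 2 volume := memLp_two_of_bounded_integrable hcont.measurable hb hI0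
  have hPI : Integrable (heatSmooth (t / 2) (eigSpan f c)) := integrable_heatSmooth (half_pos ht) hI0
  have hP2 : Integrable fun x => heatSmooth (t / 2) (eigSpan f c) x ^ 2 := (memLp_two_heatSmooth (half_pos ht) hm2).integrable_sq
  rw [l2_eq_fourier hI0 hS0, l2_eq_fourier hPI hP2]
  have hF : Integrable fun ξ => ‖𝓕 (cpx (eigSpan f c)) ξ‖ ^ 2 := integrable_norm_sq_fourier_cpx hI0 hS0
  have hE : Integrable fun ξ => Real.exp (-(2 * π ^ 2 * t * ‖ξ‖ ^ 2)) * ‖𝓕 (cpx (eigSpan f c)) ξ‖ ^ 2 := by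
    refine (hF.bdd_mul (c := 1) ?_ (ae_of_all _ fun ξ => ?_))
    · exact (Real.continuous_exp.comp (by fun_prop)).aestronglyMeasurable
    · rw [Real.norm_eq_abs, abs_of_pos (Real.exp_pos _)]
      have hpos : 0 ≤ 2 * π ^ 2 * t * ‖ξ‖ ^ 2 := by positivity
      exact Real.exp_le_one_iff.mpr (by linarith)
  simp_rw [norm_sq_fourier_cpx_heatSmooth_half ht hI0]
  rw [← integral_sub hF hE, ← integral_const_mul]
  refine integral_congr_ae (Eventually.of_forall fun ξ => ?_)
  show 1 / t * (‖𝓕 (cpx (eigSpan f c)) ξ‖ ^ 2 - Real.exp (-(2 * π ^ 2 * t * ‖ξ‖ ^ 2)) * ‖𝓕 (cpx (eigSpan f c)) ξ‖ ^ 2) =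
    (1 - Real.exp (-(t * (2 * π ^ 2 * ‖ξ‖ ^ 2)))) / t * ‖𝓕 (cpx (eigSpan f c)) ξ‖ ^ 2
  rw [show t * (2 * π ^ 2 * ‖ξ‖ ^ 2) = 2 * π ^ 2 * t * ‖ξ‖ ^ 2 by ring]
  field_simp

/-- **Second-order lower bound of the span's jump form**: `flatJump t F ≥ ½∫‖∇F‖² − (t/2)∫(H₀F)²`. [folklore] -/
theorem flatJump_eigSpan_ge (c : Fin (m + 1) → ℝ) {t : ℝ} (ht : 0 < t) :
    (1 / 2 : ℝ) * (∫ x, ‖gradient (eigSpan f c) x‖ ^ 2) - t / 2 * ∫ x, eigSpanH0 f c x ^ 2 ≤ flatJump t (eigSpan f c) := by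
  obtain ⟨hI0, hI1, -, -, hP2, hD0, -⟩ := eigSpan_integrable hf c
  have h1 : ContDiff ℝ 1 (eigSpan f c) := (eigSpan_contDiff hf c 2).of_le (by norm_num)
  obtain ⟨hA1, hA2⟩ := integrable_symbol_mul_norm_sq_fourier hf c
  -- `½∫‖∇F‖² = ∫ a‖F̂‖²`
  have hgrad : (1 / 2 : ℝ) * ∫ x, ‖gradient (eigSpan f c) x‖ ^ 2 = ∫ ξ, 2 * π ^ 2 * ‖ξ‖ ^ 2 * ‖𝓕 (cpx (eigSpan f c)) ξ‖ ^ 2 := by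
      rw [← (half_sum_integral_pderiv_sq_eq_fourier h1 hI0 hD0 hI1 hP2).2, ← integral_finsetSum _ fun p _ => hP2 p]
      congr 1
      exact integral_congr_ae (Eventually.of_forall fun x => by
        show ‖gradient (eigSpan f c) x‖ ^ 2 = ∑ i, pderiv i (eigSpan f c) x ^ 2
        exact norm_gradient_sq _ x)
  rw [hgrad, integral_eigSpanH0_sq_eq_fourier hf c, flatJump_eigSpan_eq_fourier hf c ht, ← integral_const_mul,
    ← integral_sub hA1 (hA2.const_mul _)]
  -- pointwise multiplier inequality; the right side is integrable (difference of integrable terms dominates? use mono)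
  have hR : Integrable fun ξ : ZM => (1 - Real.exp (-(t * (2 * π ^ 2 * ‖ξ‖ ^ 2)))) / t * ‖𝓕 (cpx (eigSpan f c)) ξ‖ ^ 2 := by
    have hF : Integrable fun ξ => ‖𝓕 (cpx (eigSpan f c)) ξ‖ ^ 2 :=
      integrable_norm_sq_fourier_cpx hI0 (eigSpan_integrable hf c).2.2.2.1
    refine hF.bdd_mul (c := 1 / t) ?_ (ae_of_all _ fun ξ => ?_)
    · exact ((continuous_const.sub (Real.continuous_exp.comp (by fun_prop))).div_const _).aestronglyMeasurable
    · have hx : 0 ≤ t * (2 * π ^ 2 * ‖ξ‖ ^ 2) := by positivity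
      have h1' : 0 ≤ 1 - Real.exp (-(t * (2 * π ^ 2 * ‖ξ‖ ^ 2))) := by
        rw [sub_nonneg]; exact Real.exp_le_one_iff.mpr (by linarith)
      have h2' : 1 - Real.exp (-(t * (2 * π ^ 2 * ‖ξ‖ ^ 2))) ≤ 1 := by linarith [Real.exp_pos (-(t * (2 * π ^ 2 * ‖ξ‖ ^ 2)))]
      rw [Real.norm_eq_abs, abs_of_nonneg (div_nonneg h1' ht.le)]
      exact div_le_div_of_nonneg_right h2' ht.le
  refine integral_mono (hA1.sub (hA2.const_mul _)) hR fun ξ => ?_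
  have hm := mult_ge ht (by positivity : (0:ℝ) ≤ 2 * π ^ 2 * ‖ξ‖ ^ 2)
  have hn := sq_nonneg ‖𝓕 (cpx (eigSpan f c)) ξ‖
  show 2 * π ^ 2 * ‖ξ‖ ^ 2 * ‖𝓕 (cpx (eigSpan f c)) ξ‖ ^ 2 - t / 2 * ((2 * π ^ 2 * ‖ξ‖ ^ 2) ^ 2 * ‖𝓕 (cpx (eigSpan f c)) ξ‖ ^ 2)
    ≤ (1 - Real.exp (-(t * (2 * π ^ 2 * ‖ξ‖ ^ 2)))) / t * ‖𝓕 (cpx (eigSpan f c)) ξ‖ ^ 2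
  nlinarith [mul_le_mul_of_nonneg_right hm hn]

/-- **III.8 — the span bound with an `O(t)` deficit**: for an AL1 eigenfamily there is `K ≥ 0` with
`Σ c_j² E_j − K·t·Σ c_j² ≤ kacForm t (Σ c_j f_j)` for all `t > 0` and all coefficients. [cite: SimonB1983DiscreteSpectrum, §3] -/
theorem kacForm_span_ge : ∃ K : ℝ, 0 ≤ K ∧ ∀ t : ℝ, 0 < t → ∀ c : Fin (m + 1) → ℝ,
    (∑ j, c j ^ 2 * physLevel ((j : ℕ) + 1)) - K * t * ∑ j, c j ^ 2 ≤ kacForm t (fun x => ∑ j, c j * f j x) := by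
  set K₀ : ℝ := ∑ j : Fin (m + 1), ∫ x, ((physLevel ((j : ℕ) + 1) - luscherPotential x) * f j x) ^ 2 with hK₀
  have hK₀0 : 0 ≤ K₀ := Finset.sum_nonneg fun j _ => integral_nonneg fun x => sq_nonneg _
  refine ⟨K₀ / 2, by positivity, fun t ht c => ?_⟩
  have hF : IsKacFn (eigSpan f c) := isKacFn_span hf c
  -- energyForm F = ½∫‖∇F‖² + ∫ V F²
  obtain ⟨-, -, -, -, hP2, -, -⟩ := eigSpan_integrable hf c
  have hG : Integrable fun x => ‖gradient (eigSpan f c) x‖ ^ 2 := by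
    refine (integrable_finsetSum Finset.univ fun p _ => hP2 p).congr (Eventually.of_forall fun x => ?_)
    show ∑ i, pderiv i (eigSpan f c) x ^ 2 = ‖gradient (eigSpan f c) x‖ ^ 2
    exact (norm_gradient_sq _ x).symm
  have hV : Integrable fun x => luscherPotential x * eigSpan f c x ^ 2 := hF.integrable_potential_sq
  have hEsplit : energyForm (eigSpan f c) = (1 / 2 : ℝ) * (∫ x, ‖gradient (eigSpan f c) x‖ ^ 2) +
      ∫ x, luscherPotential x * eigSpan f c x ^ 2 := by
    rw [energyForm, integral_add (hG.const_mul _) hV, integral_const_mul]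
  have hEspan : energyForm (eigSpan f c) = ∑ j, c j ^ 2 * physLevel ((j : ℕ) + 1) := by
    rw [eigSpan_eq]; exact energyForm_span hf c
  have h8 := flatJump_eigSpan_ge hf c ht
  have hH := (integral_eigSpanH0_sq_le hf c).2
  have hkac : kacForm t (fun x => ∑ j, c j * f j x) = flatJump t (eigSpan f c) + ∫ x, luscherPotential x * eigSpan f c x ^ 2 := rfl
  rw [hkac, ← hEspan, hEsplit]
  have ht2 : 0 ≤ t / 2 := by positivity
  nlinarith [mul_le_mul_of_nonneg_left hH ht2]

end SpanBound

end Summit.QuantumFields.YangMills.Theorems.FemtoTransferGap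

end
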